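import Mathlib
import HarnessLib

/-!
# Graeffe root squaring and the root-radius sandwich

The (Dandelin–Lobachevsky–)Graeffe iterate of a polynomial `p` of degree `n` over a commutative
ring is the polynomial `G(p)` with
`G(p)(x²) = (-1)ⁿ · p(x) · p(-x)`                                   [Hildebrand1987, §10.17 (10.17.6)];
in terms of the even/odd split `p(x) = pₑ(x²) + x · pₒ(x²)` it is
`G(p) = (-1)ⁿ · (pₑ² − X · pₒ²)`                                   [BeckerEtAl2018, Def. 2],
which is the definition used here (`graeffe`).  We prove the defining identity (`expand_graeffe`,
`eval_graeffe_sq`), uniqueness (`graeffe_eq_of_expand_eq`), multiplicativity (`graeffe_mul`),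
`deg G(p) = deg p` and `lc G(p) = lc(p)²` over a domain (`natDegree_graeffe`,
`leadingCoeff_graeffe`), and the root relation: every root `z` of `p` gives the root `z²` of
`G(p)` (`isRoot_graeffe`), `p.roots.map (·²) ≤ G(p).roots`, with equality when `p` has a full
set of roots (`roots_graeffe_of_card`: `G(p) = lc² · ∏ (X − zᵢ²)`, [BeckerEtAl2018, Thm. 3, first
part]); all of this for the `k`-fold iterate `G^[k]`, whose roots are the `zᵢ^(2^k)`.

Root radius (the use of Graeffe iteration in validated root finding, [BeckerEtAl2018, §3.2]).  Over
a normed field put `β(p) := max_{i<n} (‖aᵢ‖/‖aₙ‖)^{1/(n-i)}` (`coeffRadius`).  Then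
* every root satisfies `‖z‖ ≤ 2 · β(p)` (`nnnorm_le_two_mul_coeffRadius`; the inclusion radius
  `2 · max |a_{n-m}/aₙ|^{1/m}` of [Henrici1974, §6.4 Cor. 6.4k]);
* if `p` has `n` roots (with multiplicity) all of norm `≤ r`, then `β(p) ≤ n · r`
  (`coeffRadius_le_of_roots_le`, from `|aᵢ/aₙ| = |e_{n-i}(roots)| ≤ C(n,i) · r^{n-i}`,
  `norm_coeff_prod_X_sub_C_le`);
* hence the computable quantity `R_k(p) := (2 · β(G^[k] p))^(1/2^k)` (`graeffeBound`) satisfies the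
  ROOT-RADIUS SANDWICH `ρ(p) ≤ R_k(p) ≤ (2n)^(1/2^k) · ρ(p)` where `ρ(p)` is the largest root norm
  (`rootRadius_le_graeffeBound`, `graeffeBound_le_mul_rootRadius`), and `R_k(p) → ρ(p)`
  (`tendsto_graeffeBound`): `k` root squarings certify the root radius to relative accuracy
  `(2n)^(2^-k)`.

Conventions: ascending coefficients `a_i = p.coeff i`, `n = p.natDegree`; Mathlib's `expand R 2 q`
is `q(X²)`.  Not here: the coefficient recursion with detached coefficients
[Hildebrand1987, (10.17.17)], the second part of [BeckerEtAl2018, Thm. 3] (norm growth of the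
coefficients), and the combination with Pellet's test (`Literature.Analysis.Complex.PelletTheorem`).

References: [Hildebrand1987] F. B. Hildebrand, Introduction to Numerical Analysis, 2nd ed., Dover
1987, §10.17; [BeckerEtAl2018] R. Becker, M. Sagraloff, V. Sharma, C. Yap, J. Symb. Comput. 86
(2018), §3.2 Def. 2, Thm. 3; [Henrici1974] P. Henrici, Applied and Computational Complex Analysis
I, Wiley 1974, §6.4 Cor. 6.4k.
-/

open Polynomial Finset Filter Topology NNReal

namespace Literature.Algebra.Polynomial.Graeffe

section CommRing

variable {R : Type*} [CommRing R]

/-- Even part `pₑ` of `p`: `pₑ.coeff j = p.coeff (2j)`. [folklore] -/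
noncomputable def evenPart (p : R[X]) : R[X] := contract 2 p

/-- Odd part `pₒ` of `p`: `pₒ.coeff j = p.coeff (2j+1)`. [folklore] -/
noncomputable def oddPart (p : R[X]) : R[X] := contract 2 (divX p)

/-- [folklore] -/
private theorem coeff_evenPart (p : R[X]) (j : ℕ) : (evenPart p).coeff j = p.coeff (2 * j) := by
  rw [evenPart, coeff_contract two_ne_zero, mul_comm]

/-- [folklore] -/
private theorem coeff_oddPart (p : R[X]) (j : ℕ) : (oddPart p).coeff j = p.coeff (2 * j + 1) := by
  rw [oddPart, coeff_contract two_ne_zero, coeff_divX, mul_comm]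

/-- The even/odd split `p(x) = pₑ(x²) + x · pₒ(x²)`. [cite: BeckerEtAl2018, Def. 2] -/
theorem expand_evenPart_add (p : R[X]) :
    expand R 2 (evenPart p) + X * expand R 2 (oddPart p) = p := by
  ext n
  rw [coeff_add]
  obtain ⟨j, rfl | rfl⟩ := Nat.even_or_odd' n
  · rw [coeff_expand two_pos, if_pos (dvd_mul_right 2 j), Nat.mul_div_cancel_left j two_pos,
      coeff_evenPart]
    rcases j with _ | j
    · simp
    · rw [show 2 * (j + 1) = (2 * j + 1) + 1 by ring, coeff_X_mul, coeff_expand two_pos,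
        if_neg (by omega), add_zero]
  · rw [coeff_X_mul, coeff_expand two_pos, if_neg (by omega), zero_add, coeff_expand two_pos,
      if_pos (dvd_mul_right 2 j), Nat.mul_div_cancel_left j two_pos, coeff_oddPart]

/-- **The Graeffe iterate** (Dandelin–Graeffe formula) `G(p) := (-1)ⁿ · (pₑ² − X · pₒ²)`,
`n = natDegree p`. [cite: BeckerEtAl2018, Def. 2] -/
noncomputable def graeffe (p : R[X]) : R[X] :=
  C ((-1 : R) ^ p.natDegree) * (evenPart p ^ 2 - X * oddPart p ^ 2)

/-- A polynomial in `X²` is even. [folklore] -/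
private theorem expand_two_comp_neg_X (f : R[X]) : (expand R 2 f).comp (-X) = expand R 2 f := by
  rw [expand_eq_comp_X_pow, comp_assoc]
  congr 1
  simp

/-- `p(-x) = pₑ(x²) − x · pₒ(x²)`. [folklore] -/
private theorem comp_neg_X_eq (p : R[X]) :
    p.comp (-X) = expand R 2 (evenPart p) - X * expand R 2 (oddPart p) := by
  conv_lhs => rw [← expand_evenPart_add p]
  rw [add_comp, mul_comp, X_comp, expand_two_comp_neg_X, expand_two_comp_neg_X]
  ring

/-- **Defining identity of root squaring**: `G(p)(x²) = (-1)ⁿ · p(x) · p(-x)`.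
[cite: Hildebrand1987, §10.17 (10.17.6)] [cite: BeckerEtAl2018, Thm. 3 (proof)] -/
theorem expand_graeffe (p : R[X]) :
    expand R 2 (graeffe p) = C ((-1 : R) ^ p.natDegree) * (p * p.comp (-X)) := by
  rw [comp_neg_X_eq]
  simp only [graeffe, map_mul, map_sub, map_pow, expand_C, expand_X]
  linear_combination (C (-1 : R) ^ p.natDegree *
    (expand R 2 (evenPart p) - X * expand R 2 (oddPart p))) * expand_evenPart_add p

/-- Evaluation form: `G(p)(x²) = (-1)ⁿ p(x) p(-x)`. [cite: Hildebrand1987, §10.17 (10.17.6)] -/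
theorem eval_graeffe_sq (p : R[X]) (x : R) :
    (graeffe p).eval (x ^ 2) = (-1) ^ p.natDegree * (p.eval x * p.eval (-x)) := by
  have h := congrArg (eval x) (expand_graeffe p)
  rw [expand_eval] at h
  rw [h, eval_mul, eval_C, eval_mul, eval_comp, eval_neg, eval_X]

/-- **Roots are squared**: a root `z` of `p` gives the root `z²` of `G(p)`.
[cite: Hildebrand1987, §10.17] [cite: BeckerEtAl2018, Thm. 3] -/
theorem isRoot_graeffe {p : R[X]} {x : R} (h : p.IsRoot x) : (graeffe p).IsRoot (x ^ 2) := by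
  rw [IsRoot.def, eval_graeffe_sq, h.eq_zero, zero_mul, mul_zero]

/-- [cite: BeckerEtAl2018, Def. 2 (Graeffe iterate) — elementary algebraic consequence, folklore] -/
theorem graeffe_zero : graeffe (0 : R[X]) = 0 := by
  simp [graeffe, evenPart, oddPart, contract]

/-- Uniqueness: `G(p)` is the only polynomial `q` with `q(x²) = (-1)ⁿ p(x) p(-x)`. [folklore] -/
private theorem graeffe_eq_of_expand_eq {p q : R[X]}
    (h : expand R 2 q = C ((-1 : R) ^ p.natDegree) * (p * p.comp (-X))) : graeffe p = q :=
  expand_injective two_pos (by rw [expand_graeffe, h])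

/-- `G(c) = c²`. [cite: BeckerEtAl2018, Def. 2 (Graeffe iterate) — elementary algebraic consequence, folklore] -/
theorem graeffe_C (a : R) : graeffe (C a) = C (a ^ 2) := by
  apply graeffe_eq_of_expand_eq
  rw [expand_C, natDegree_C, pow_zero, C_1, one_mul, C_comp, ← C_mul, sq]

/-- [cite: BeckerEtAl2018, Def. 2 (Graeffe iterate) — elementary algebraic consequence, folklore] -/
theorem graeffe_one : graeffe (1 : R[X]) = 1 := by
  rw [← C_1, graeffe_C, one_pow]

/-- `G(X − a) = X − a²`. [cite: Hildebrand1987, §10.17 (10.17.6)] -/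
theorem graeffe_X_sub_C (a : R) : graeffe (X - C a) = X - C (a ^ 2) := by
  nontriviality R
  apply graeffe_eq_of_expand_eq
  rw [natDegree_X_sub_C, map_sub, expand_X, expand_C, sub_comp, X_comp, C_comp, pow_one, C_neg,
    C_1, map_pow]
  ring

/-- **Multiplicativity** `G(p · q) = G(p) · G(q)` (over a domain, where degrees add). [cite: BeckerEtAl2018,
Def. 2 (Graeffe iterate) — elementary algebraic consequence, folklore] -/
theorem graeffe_mul [NoZeroDivisors R] (p q : R[X]) : graeffe (p * q) = graeffe p * graeffe q := by
  rcases eq_or_ne p 0 with rfl | hp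
  · rw [zero_mul, graeffe_zero, zero_mul]
  rcases eq_or_ne q 0 with rfl | hq
  · rw [mul_zero, graeffe_zero, mul_zero]
  apply graeffe_eq_of_expand_eq
  rw [map_mul, expand_graeffe, expand_graeffe, natDegree_mul hp hq, pow_add, C_mul, mul_comp]
  ring

/-- [cite: BeckerEtAl2018, Def. 2 (Graeffe iterate) — elementary algebraic consequence, folklore] -/
theorem graeffe_multiset_prod [NoZeroDivisors R] (s : Multiset R[X]) :
    graeffe s.prod = (s.map graeffe).prod := by
  induction s using Multiset.induction_on with
  | empty => simp [graeffe_one]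
  | cons a s ih => rw [Multiset.prod_cons, graeffe_mul, ih, Multiset.map_cons, Multiset.prod_cons]

/-- `G(∏ (X − zᵢ)) = ∏ (X − zᵢ²)`. [cite: Hildebrand1987, §10.17 (10.17.6)] [cite: BeckerEtAl2018, Thm. 3] -/
theorem graeffe_prod_X_sub_C [NoZeroDivisors R] (s : Multiset R) :
    graeffe (s.map fun a => X - C a).prod = (s.map fun a => X - C (a ^ 2)).prod := by
  rw [graeffe_multiset_prod, Multiset.map_map]
  congr 1
  exact Multiset.map_congr rfl fun a _ => graeffe_X_sub_C a

/-- **Degree is preserved**: `deg G(p) = deg p` (over a domain). [cite: BeckerEtAl2018, Thm. 3] -/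
theorem natDegree_graeffe [NoZeroDivisors R] (p : R[X]) : (graeffe p).natDegree = p.natDegree := by
  rcases eq_or_ne p 0 with rfl | hp
  · rw [graeffe_zero]
  haveI := Nontrivial.of_polynomial_ne hp
  have h := congrArg natDegree (expand_graeffe p)
  rw [natDegree_expand] at h
  have hc : p.comp (-X) ≠ 0 := by rwa [Ne, comp_neg_X_eq_zero_iff]
  have h2 : (C ((-1 : R) ^ p.natDegree) * (p * p.comp (-X))).natDegree = 2 * p.natDegree := by
    rcases neg_one_pow_eq_or R p.natDegree with h1 | h1
    · rw [h1, C_1, one_mul, natDegree_mul hp hc, natDegree_comp, natDegree_neg, natDegree_X]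
      ring
    · rw [h1, C_neg, C_1, neg_one_mul, natDegree_neg, natDegree_mul hp hc, natDegree_comp,
        natDegree_neg, natDegree_X]
      ring
  omega

/-- **Leading coefficient** `lc G(p) = lc(p)²`. [cite: BeckerEtAl2018, Thm. 3] -/
theorem leadingCoeff_graeffe [NoZeroDivisors R] (p : R[X]) :
    (graeffe p).leadingCoeff = p.leadingCoeff ^ 2 := by
  have hsq : ((-1 : R) ^ p.natDegree) ^ 2 = 1 := by
    rw [← pow_mul, mul_comm, pow_mul, neg_one_sq, one_pow]
  rw [← leadingCoeff_expand two_pos, expand_graeffe, leadingCoeff_mul, leadingCoeff_mul,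
    leadingCoeff_C, comp_neg_X_leadingCoeff_eq]
  linear_combination (p.leadingCoeff ^ 2) * hsq

/-- `G` preserves monicity. [cite: Hildebrand1987, §10.17] -/
theorem monic_graeffe [NoZeroDivisors R] {p : R[X]} (hp : p.Monic) : (graeffe p).Monic := by
  rw [Monic, leadingCoeff_graeffe, hp.leadingCoeff, one_pow]

/-- [cite: BeckerEtAl2018, Def. 2 (Graeffe iterate) — elementary algebraic consequence, folklore] -/
theorem graeffe_ne_zero [NoZeroDivisors R] {p : R[X]} (hp : p ≠ 0) : graeffe p ≠ 0 := by
  intro h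
  have h1 := leadingCoeff_graeffe p
  rw [h, leadingCoeff_zero] at h1
  exact pow_ne_zero 2 (leadingCoeff_ne_zero.mpr hp) h1.symm

/-- The squares of the roots of `p` are roots of `G(p)`, with multiplicity. [cite: BeckerEtAl2018, Thm. 3] -/
theorem roots_map_sq_le [IsDomain R] (p : R[X]) : p.roots.map (· ^ 2) ≤ (graeffe p).roots := by
  rcases eq_or_ne p 0 with rfl | hp
  · simp [graeffe_zero]
  obtain ⟨q, hq, -, -⟩ := exists_prod_multiset_X_sub_C_mul p
  have hG : graeffe p = ((p.roots.map (· ^ 2)).map fun b => X - C b).prod * graeffe q := by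
    conv_lhs => rw [← hq]
    rw [graeffe_mul, graeffe_prod_X_sub_C, Multiset.map_map]
    rfl
  have hne : ((p.roots.map (· ^ 2)).map fun b => X - C b).prod * graeffe q ≠ 0 :=
    hG ▸ graeffe_ne_zero hp
  rw [hG, roots_mul hne, roots_multiset_prod_X_sub_C]
  exact Multiset.le_add_right _ _

/-- **`G(p) = lc(p)² · ∏ (X − zᵢ²)`**: if `p` has a full set of roots `z₁, …, zₙ` (with multiplicity),
the roots of `G(p)` are exactly the `zᵢ²`. [cite: BeckerEtAl2018, Thm. 3] [cite: Hildebrand1987, §10.17] -/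
theorem roots_graeffe_of_card [IsDomain R] {p : R[X]} (h : Multiset.card p.roots = p.natDegree) :
    (graeffe p).roots = p.roots.map (· ^ 2) := by
  rcases eq_or_ne p 0 with rfl | hp
  · simp [graeffe_zero]
  have hG : graeffe p = C (p.leadingCoeff ^ 2) * ((p.roots.map (· ^ 2)).map fun b => X - C b).prod := by
    conv_lhs => rw [← C_leadingCoeff_mul_prod_multiset_X_sub_C h]
    rw [graeffe_mul, graeffe_C, graeffe_prod_X_sub_C, Multiset.map_map]
    rfl
  rw [hG, roots_C_mul _ (pow_ne_zero 2 (leadingCoeff_ne_zero.mpr hp)), roots_multiset_prod_X_sub_C]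

/-! ### Iterated root squaring `G^[k]` -/

/-- [cite: BeckerEtAl2018, Def. 2 (Graeffe iterate) — elementary algebraic consequence, folklore] -/
theorem natDegree_graeffe_iterate [NoZeroDivisors R] (p : R[X]) (k : ℕ) :
    (graeffe^[k] p).natDegree = p.natDegree := by
  induction k with
  | zero => rfl
  | succ k ih => rw [Function.iterate_succ_apply', natDegree_graeffe, ih]

/-- `lc G^[k](p) = lc(p)^(2^k)`. [cite: BeckerEtAl2018, Def. 2 (Graeffe iterate) — elementary algebraic
consequence, folklore] -/
theorem leadingCoeff_graeffe_iterate [NoZeroDivisors R] (p : R[X]) (k : ℕ) :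
    (graeffe^[k] p).leadingCoeff = p.leadingCoeff ^ 2 ^ k := by
  induction k with
  | zero => simp
  | succ k ih => rw [Function.iterate_succ_apply', leadingCoeff_graeffe, ih, ← pow_mul, pow_succ]

/-- [cite: BeckerEtAl2018, Def. 2 (Graeffe iterate) — elementary algebraic consequence, folklore] -/
theorem graeffe_iterate_ne_zero [NoZeroDivisors R] {p : R[X]} (hp : p ≠ 0) (k : ℕ) :
    graeffe^[k] p ≠ 0 := by
  induction k with
  | zero => exact hp
  | succ k ih => rw [Function.iterate_succ_apply']; exact graeffe_ne_zero ih

/-- After `k` root squarings a root `z` of `p` gives the root `z^(2^k)`. [cite: Hildebrand1987, §10.17] -/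
theorem isRoot_graeffe_iterate {p : R[X]} {x : R} (h : p.IsRoot x) (k : ℕ) :
    (graeffe^[k] p).IsRoot (x ^ 2 ^ k) := by
  induction k with
  | zero => simpa using h
  | succ k ih =>
    rw [Function.iterate_succ_apply', pow_succ, pow_mul]
    exact isRoot_graeffe ih

/-- `G^[k](X − a) = X − a^(2^k)`. [cite: Hildebrand1987, §10.17 (10.17.6)–(10.17.7)] -/
theorem graeffe_iterate_X_sub_C (a : R) (k : ℕ) : graeffe^[k] (X - C a) = X - C (a ^ 2 ^ k) := by
  induction k with
  | zero => simp
  | succ k ih => rw [Function.iterate_succ_apply', ih, graeffe_X_sub_C, ← pow_mul, pow_succ]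

/-- The roots of `G^[k](p)` are the `zᵢ^(2^k)` (full set of roots). [cite: Hildebrand1987, §10.17 (10.17.7)] -/
theorem roots_graeffe_iterate_of_card [IsDomain R] {p : R[X]}
    (h : Multiset.card p.roots = p.natDegree) (k : ℕ) :
    (graeffe^[k] p).roots = p.roots.map (· ^ 2 ^ k) := by
  induction k with
  | zero => simp
  | succ k ih =>
    have hk : Multiset.card (graeffe^[k] p).roots = (graeffe^[k] p).natDegree := by
      rw [ih, Multiset.card_map, natDegree_graeffe_iterate, h]
    rw [Function.iterate_succ_apply', roots_graeffe_of_card hk, ih, Multiset.map_map]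
    congr 1
    funext z
    simp [pow_succ, pow_mul]

end CommRing

/-! ### Root radius: the coefficient radius `β`, Cauchy–Fujiwara-type bound, and the Graeffe sandwich -/

section Normed

variable {K : Type*} [NormedField K]

/-- `Σ_{i<n} (1/2)^(n-i) = 1 − (1/2)^n`. [folklore] -/
private theorem sum_half_pow_sub (n : ℕ) :
    ∑ i ∈ range n, (2⁻¹ : ℝ) ^ (n - i) = 1 - 2⁻¹ ^ n := by
  induction n with
  | zero => simp
  | succ n ih =>
    rw [sum_range_succ, Nat.add_sub_cancel_left, pow_one]
    have : ∑ i ∈ range n, (2⁻¹ : ℝ) ^ (n + 1 - i) = 2⁻¹ * ∑ i ∈ range n, (2⁻¹ : ℝ) ^ (n - i) := by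
      rw [mul_sum]
      refine sum_congr rfl fun i hi => ?_
      rw [Finset.mem_range] at hi
      rw [show n + 1 - i = (n - i) + 1 by omega, pow_succ, mul_comm]
    rw [this, ih, pow_succ]
    ring

/-- The **coefficient radius** (gauge) `β(p) := max_{i<n} (‖aᵢ‖/‖aₙ‖)^{1/(n−i)} = max_{1≤m≤n} |a_{n−m}/aₙ|^{1/m}`
(`= 0` for `n = 0`). [cite: Henrici1974, §6.4 Cor. 6.4k (half the inclusion radius there)] -/
noncomputable def coeffRadius (p : K[X]) : ℝ≥0 :=
  (range p.natDegree).sup fun i =>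
    (‖p.coeff i‖₊ / ‖p.leadingCoeff‖₊) ^ (((p.natDegree - i : ℕ) : ℝ)⁻¹)

/-- Unfolding the coefficient radius: `‖aᵢ‖ ≤ ‖aₙ‖ · β^(n−i)` for `i < n`. [folklore] -/
private theorem nnnorm_coeff_le_coeffRadius_pow {p : K[X]} (hp : p ≠ 0) {i : ℕ} (hi : i < p.natDegree) :
    ‖p.coeff i‖₊ ≤ ‖p.leadingCoeff‖₊ * coeffRadius p ^ (p.natDegree - i) := by
  have hlc : 0 < ‖p.leadingCoeff‖₊ := nnnorm_pos.mpr (leadingCoeff_ne_zero.mpr hp)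
  have hm : p.natDegree - i ≠ 0 := Nat.sub_ne_zero_of_lt hi
  have h1 : (‖p.coeff i‖₊ / ‖p.leadingCoeff‖₊) ^ (((p.natDegree - i : ℕ) : ℝ)⁻¹) ≤ coeffRadius p :=
    Finset.le_sup (f := fun i => (‖p.coeff i‖₊ / ‖p.leadingCoeff‖₊) ^
      (((p.natDegree - i : ℕ) : ℝ)⁻¹)) (Finset.mem_range.mpr hi)
  have h2 : ‖p.coeff i‖₊ / ‖p.leadingCoeff‖₊ ≤ coeffRadius p ^ (p.natDegree - i) := by
    calc ‖p.coeff i‖₊ / ‖p.leadingCoeff‖₊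
        = ((‖p.coeff i‖₊ / ‖p.leadingCoeff‖₊) ^ (((p.natDegree - i : ℕ) : ℝ)⁻¹)) ^
            (p.natDegree - i) := (rpow_inv_natCast_pow _ hm).symm
      _ ≤ coeffRadius p ^ (p.natDegree - i) := by gcongr
  rwa [div_le_iff₀ hlc, mul_comm] at h2

/-- Core of the Cauchy–Fujiwara argument: a root of positive norm `t` with `2β ≤ t` is impossible.
[cite: Henrici1974, §6.4 Cor. 6.4k (proof via Thm. 6.4i)] -/
theorem false_of_two_mul_coeffRadius_le {p : K[X]} (hp : p ≠ 0) {z : K} (hz : p.IsRoot z)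
    (ht : 0 < ‖z‖) (h : 2 * (coeffRadius p : ℝ) ≤ ‖z‖) : False := by
  set n := p.natDegree with hn
  set b : ℝ := (coeffRadius p : ℝ) with hb
  set t : ℝ := ‖z‖ with htdef
  have hb0 : 0 ≤ b := (coeffRadius p).coe_nonneg
  have hlc : 0 < ‖p.leadingCoeff‖ := norm_pos_iff.mpr (leadingCoeff_ne_zero.mpr hp)
  -- the root equation: `aₙ zⁿ = - Σ_{i<n} aᵢ zⁱ`
  have hroot : p.leadingCoeff * z ^ n = -∑ i ∈ range n, p.coeff i * z ^ i := by
    have h0 := hz.eq_zero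
    rw [eval_eq_sum_range, sum_range_succ] at h0
    rw [hn, ← coeff_natDegree]
    linear_combination h0
  -- coefficient bounds
  have hcoef : ∀ i ∈ range n, ‖p.coeff i * z ^ i‖ ≤ ‖p.leadingCoeff‖ * ((t / 2) ^ (n - i) * t ^ i) := by
    intro i hi
    rw [Finset.mem_range] at hi
    have h1 : (‖p.coeff i‖₊ : ℝ) ≤ ‖p.leadingCoeff‖₊ * coeffRadius p ^ (n - i) := by
      exact_mod_cast nnnorm_coeff_le_coeffRadius_pow hp hi
    rw [coe_nnnorm, coe_nnnorm] at h1
    rw [norm_mul, norm_pow]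
    calc ‖p.coeff i‖ * t ^ i ≤ ‖p.leadingCoeff‖ * b ^ (n - i) * t ^ i := by gcongr
      _ ≤ ‖p.leadingCoeff‖ * (t / 2) ^ (n - i) * t ^ i := by gcongr; linarith
      _ = ‖p.leadingCoeff‖ * ((t / 2) ^ (n - i) * t ^ i) := by ring
  have hsum : ∑ i ∈ range n, (t / 2) ^ (n - i) * t ^ i = t ^ n * (1 - 2⁻¹ ^ n) := by
    rw [← sum_half_pow_sub, mul_sum]
    refine sum_congr rfl fun i hi => ?_
    rw [Finset.mem_range] at hi
    rw [div_eq_mul_inv, mul_pow, show t ^ n = t ^ (n - i) * t ^ i by rw [← pow_add]; congr 1; omega]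
    ring
  have key : ‖p.leadingCoeff‖ * t ^ n ≤ ‖p.leadingCoeff‖ * (t ^ n * (1 - 2⁻¹ ^ n)) := by
    calc ‖p.leadingCoeff‖ * t ^ n = ‖p.leadingCoeff * z ^ n‖ := by rw [norm_mul, norm_pow]
      _ = ‖∑ i ∈ range n, p.coeff i * z ^ i‖ := by rw [hroot, norm_neg]
      _ ≤ ∑ i ∈ range n, ‖p.coeff i * z ^ i‖ := norm_sum_le _ _
      _ ≤ ∑ i ∈ range n, ‖p.leadingCoeff‖ * ((t / 2) ^ (n - i) * t ^ i) := sum_le_sum hcoef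
      _ = ‖p.leadingCoeff‖ * (t ^ n * (1 - 2⁻¹ ^ n)) := by rw [← mul_sum, hsum]
  have htn : 0 < t ^ n := pow_pos ht n
  have h2n : (0 : ℝ) < 2⁻¹ ^ n := pow_pos (by norm_num) n
  nlinarith [mul_pos hlc (mul_pos htn h2n)]

/-- **Cauchy–Fujiwara-type inclusion radius**: every root satisfies `‖z‖ ≤ 2 · β(p)`, i.e. all zeros
lie in the disc of radius `2 · max_{1≤m≤n} |a_{n−m}/aₙ|^{1/m}`. [cite: Henrici1974, §6.4 Cor. 6.4k] -/
theorem nnnorm_le_two_mul_coeffRadius {p : K[X]} (hp : p ≠ 0) {z : K} (hz : p.IsRoot z) :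
    ‖z‖₊ ≤ 2 * coeffRadius p := by
  by_contra h
  push Not at h
  have h' : 2 * (coeffRadius p : ℝ) < ‖z‖ := by exact_mod_cast h
  have ht : 0 < ‖z‖ := lt_of_le_of_lt (by positivity) h'
  exact false_of_two_mul_coeffRadius_le hp hz ht h'.le

/-- Strict form for non-zero roots: `‖z‖ < 2 · β(p)`. [cite: Henrici1974, §6.4 Cor. 6.4k ("open disk")] -/
theorem nnnorm_lt_two_mul_coeffRadius {p : K[X]} (hp : p ≠ 0) {z : K} (hz : p.IsRoot z) (hz0 : z ≠ 0) :
    ‖z‖₊ < 2 * coeffRadius p := by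
  by_contra h
  push Not at h
  have h' : 2 * (coeffRadius p : ℝ) ≤ ‖z‖ := by exact_mod_cast h
  exact false_of_two_mul_coeffRadius_le hp hz (norm_pos_iff.mpr hz0) h'

/-- **Vieta bound**: if all `zᵢ` have norm `≤ r`, the coefficients of `∏_{i≤m} (X − zᵢ)` satisfy
`‖cₖ‖ ≤ C(m,k) · r^(m−k)` (`|e_{m−k}(z)| ≤ C(m,k) r^{m−k}`). [folklore] -/
private theorem norm_coeff_prod_X_sub_C_le (s : Multiset K) {r : ℝ} (hr : ∀ z ∈ s, ‖z‖ ≤ r) (k : ℕ) :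
    ‖(s.map fun a => X - C a).prod.coeff k‖ ≤ (Multiset.card s).choose k * r ^ (Multiset.card s - k) := by
  induction s using Multiset.induction_on generalizing k with
  | empty =>
    rcases k with _ | k
    · simp
    · simp [coeff_one]
  | cons z s ih =>
    have hzr : ‖z‖ ≤ r := hr z (Multiset.mem_cons_self z s)
    have hr0 : 0 ≤ r := (norm_nonneg z).trans hzr
    have ih' := ih (fun w hw => hr w (Multiset.mem_cons_of_mem hw))
    set q := (s.map fun a => X - C a).prod with hq
    set m := Multiset.card s with hm
    rw [Multiset.map_cons, Multiset.prod_cons, Multiset.card_cons, sub_mul, coeff_sub, coeff_C_mul]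
    rcases k with _ | j
    · rw [coeff_X_mul_zero, zero_sub, norm_neg, norm_mul, Nat.choose_zero_right, Nat.cast_one,
        one_mul, Nat.sub_zero, pow_succ]
      have h0 := ih' 0
      rw [Nat.choose_zero_right, Nat.cast_one, one_mul, Nat.sub_zero] at h0
      calc ‖z‖ * ‖q.coeff 0‖ ≤ r * r ^ m := by gcongr
        _ = r ^ m * r := mul_comm _ _
    · rw [coeff_X_mul, Nat.choose_succ_succ, Nat.succ_sub_succ, Nat.cast_add, add_mul]
      have hj := ih' j
      have hj1 := ih' (j + 1)
      have hsecond : ‖z‖ * ‖q.coeff (j + 1)‖ ≤ (m.choose (j + 1) : ℝ) * r ^ (m - j) := by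
        rcases lt_or_ge m (j + 1) with hlt | hle
        · rw [Nat.choose_eq_zero_of_lt hlt] at hj1 ⊢
          simp only [Nat.cast_zero, zero_mul] at hj1 ⊢
          have : ‖q.coeff (j + 1)‖ = 0 := le_antisymm hj1 (norm_nonneg _)
          rw [this, mul_zero]
        · calc ‖z‖ * ‖q.coeff (j + 1)‖ ≤ r * ((m.choose (j + 1) : ℝ) * r ^ (m - (j + 1))) := by gcongr
            _ = (m.choose (j + 1) : ℝ) * r ^ (m - j) := by
              rw [show m - j = (m - (j + 1)) + 1 by omega, pow_succ]; ring
      calc ‖q.coeff j - z * q.coeff (j + 1)‖ ≤ ‖q.coeff j‖ + ‖z * q.coeff (j + 1)‖ := norm_sub_le _ _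
        _ = ‖q.coeff j‖ + ‖z‖ * ‖q.coeff (j + 1)‖ := by rw [norm_mul]
        _ ≤ (m.choose j : ℝ) * r ^ (m - j) + (m.choose (j + 1) : ℝ) * r ^ (m - j) :=
          add_le_add hj hsecond

/-- Coefficient bound for a polynomial with a full set of roots of norm `≤ r`:
`‖aᵢ‖ ≤ ‖aₙ‖ · C(n,i) · r^(n−i)`. [folklore] -/
private theorem norm_coeff_le_of_roots_le {p : K[X]} (h : Multiset.card p.roots = p.natDegree) {r : ℝ}
    (hr : ∀ z ∈ p.roots, ‖z‖ ≤ r) (i : ℕ) :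
    ‖p.coeff i‖ ≤ ‖p.leadingCoeff‖ * (p.natDegree.choose i * r ^ (p.natDegree - i)) := by
  have h1 := norm_coeff_prod_X_sub_C_le p.roots hr i
  rw [h] at h1
  conv_lhs => rw [← C_leadingCoeff_mul_prod_multiset_X_sub_C h, coeff_C_mul, norm_mul]
  gcongr

/-- **The coefficient radius is controlled by the root radius**: if `p` has `n` roots all of norm `≤ r`, then
`β(p) ≤ n · r` (from `C(n,i)^{1/(n−i)} ≤ n`). [folklore] -/
private theorem coeffRadius_le_of_roots_le {p : K[X]} (h : Multiset.card p.roots = p.natDegree) {r : ℝ≥0}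
    (hr : ∀ z ∈ p.roots, ‖z‖₊ ≤ r) : coeffRadius p ≤ p.natDegree * r := by
  rcases eq_or_ne p 0 with rfl | hp
  · simp [coeffRadius]
  have hlc : 0 < ‖p.leadingCoeff‖₊ := nnnorm_pos.mpr (leadingCoeff_ne_zero.mpr hp)
  apply Finset.sup_le
  intro i hi
  rw [Finset.mem_range] at hi
  have hm : p.natDegree - i ≠ 0 := Nat.sub_ne_zero_of_lt hi
  have h1 : ‖p.coeff i‖₊ ≤ ‖p.leadingCoeff‖₊ * (p.natDegree.choose i * r ^ (p.natDegree - i)) := by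
    have := norm_coeff_le_of_roots_le h (r := r) (fun z hz => by exact_mod_cast hr z hz) i
    exact_mod_cast this
  have h2 : ‖p.coeff i‖₊ / ‖p.leadingCoeff‖₊ ≤ (p.natDegree * r) ^ (p.natDegree - i) := by
    rw [div_le_iff₀ hlc]
    calc ‖p.coeff i‖₊ ≤ ‖p.leadingCoeff‖₊ * (p.natDegree.choose i * r ^ (p.natDegree - i)) := h1
      _ ≤ ‖p.leadingCoeff‖₊ * ((p.natDegree : ℝ≥0) ^ (p.natDegree - i) * r ^ (p.natDegree - i)) := by
          gcongr
          rw [← Nat.choose_symm hi.le]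
          exact_mod_cast Nat.choose_le_pow p.natDegree (p.natDegree - i)
      _ = (p.natDegree * r) ^ (p.natDegree - i) * ‖p.leadingCoeff‖₊ := by rw [mul_pow]; ring
  calc (‖p.coeff i‖₊ / ‖p.leadingCoeff‖₊) ^ (((p.natDegree - i : ℕ) : ℝ)⁻¹)
      ≤ ((p.natDegree * r) ^ (p.natDegree - i)) ^ (((p.natDegree - i : ℕ) : ℝ)⁻¹) := by gcongr
    _ = p.natDegree * r := pow_rpow_inv_natCast _ hm

/-- The **Graeffe root bound** after `k` root squarings: `R_k(p) := (2 · β(G^[k] p))^(1/2^k)`.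
[cite: BeckerEtAl2018, §3.2 (Graeffe iteration for root radii)] -/
noncomputable def graeffeBound (p : K[X]) (k : ℕ) : ℝ≥0 :=
  (2 * coeffRadius (graeffe^[k] p)) ^ (((2 ^ k : ℕ) : ℝ)⁻¹)

/-- **Upper bound**: every root satisfies `‖z‖ ≤ R_k(p)` for every `k`.
[cite: Henrici1974, Cor. 6.4k applied to the k-th Graeffe iterate of p] [cite: BeckerEtAl2018, §3.2] -/
theorem nnnorm_le_graeffeBound {p : K[X]} (hp : p ≠ 0) {z : K} (hz : p.IsRoot z) (k : ℕ) :
    ‖z‖₊ ≤ graeffeBound p k := by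
  have hk : (2 ^ k : ℕ) ≠ 0 := pow_ne_zero k two_ne_zero
  have h1 := nnnorm_le_two_mul_coeffRadius (graeffe_iterate_ne_zero hp k) (isRoot_graeffe_iterate hz k)
  rw [nnnorm_pow] at h1
  calc ‖z‖₊ = (‖z‖₊ ^ (2 ^ k)) ^ (((2 ^ k : ℕ) : ℝ)⁻¹) := (pow_rpow_inv_natCast _ hk).symm
    _ ≤ graeffeBound p k := by unfold graeffeBound; gcongr

/-- **Quality of the bound**: if `p` has `n` roots all of norm `≤ r`, then
`R_k(p) ≤ (2n)^(1/2^k) · r`. [cite: BeckerEtAl2018, §3.2 (cf.; the bound itself is folklore)] -/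
theorem graeffeBound_le {p : K[X]} (h : Multiset.card p.roots = p.natDegree) {r : ℝ≥0}
    (hr : ∀ z ∈ p.roots, ‖z‖₊ ≤ r) (k : ℕ) :
    graeffeBound p k ≤ (2 * p.natDegree : ℝ≥0) ^ (((2 ^ k : ℕ) : ℝ)⁻¹) * r := by
  have hk : (2 ^ k : ℕ) ≠ 0 := pow_ne_zero k two_ne_zero
  rcases eq_or_ne p 0 with rfl | hp
  · simp [graeffeBound, coeffRadius, Function.iterate_fixed graeffe_zero]
  have hroots := roots_graeffe_iterate_of_card h k
  have hcard : Multiset.card (graeffe^[k] p).roots = (graeffe^[k] p).natDegree := by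
    rw [hroots, Multiset.card_map, natDegree_graeffe_iterate, h]
  have hr' : ∀ w ∈ (graeffe^[k] p).roots, ‖w‖₊ ≤ r ^ 2 ^ k := by
    intro w hw
    rw [hroots, Multiset.mem_map] at hw
    obtain ⟨z, hz, rfl⟩ := hw
    rw [nnnorm_pow]
    exact pow_le_pow_left₀ zero_le (hr z hz) _
  have hg := coeffRadius_le_of_roots_le hcard hr'
  rw [natDegree_graeffe_iterate] at hg
  calc graeffeBound p k = (2 * coeffRadius (graeffe^[k] p)) ^ (((2 ^ k : ℕ) : ℝ)⁻¹) := rfl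
    _ ≤ (2 * (p.natDegree * r ^ 2 ^ k)) ^ (((2 ^ k : ℕ) : ℝ)⁻¹) := by gcongr
    _ = (2 * p.natDegree : ℝ≥0) ^ (((2 ^ k : ℕ) : ℝ)⁻¹) * r := by
        rw [← mul_assoc, mul_rpow, pow_rpow_inv_natCast _ hk]

/-- The **root radius** `ρ(p) := max ‖zᵢ‖` over the roots of `p` in `K` (`0` if there are none).
[folklore] -/
noncomputable def rootRadius (p : K[X]) : ℝ≥0 := (p.roots.map fun z => ‖z‖₊).sup

/-- [cite: BeckerEtAl2018, §3.2 (root radius of p) — definitional property] -/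
theorem nnnorm_le_rootRadius {p : K[X]} {z : K} (hz : z ∈ p.roots) : ‖z‖₊ ≤ rootRadius p :=
  Multiset.le_sup (Multiset.mem_map_of_mem _ hz)

/-- **Sandwich, lower half**: `ρ(p) ≤ R_k(p)`. [cite: BeckerEtAl2018, §3.2] [cite: Henrici1974, Cor. 6.4k] -/
theorem rootRadius_le_graeffeBound {p : K[X]} (hp : p ≠ 0) (k : ℕ) :
    rootRadius p ≤ graeffeBound p k := by
  apply Multiset.sup_le.mpr
  intro b hb
  rw [Multiset.mem_map] at hb
  obtain ⟨z, hz, rfl⟩ := hb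
  exact nnnorm_le_graeffeBound hp ((mem_roots hp).mp hz) k

/-- **Sandwich, upper half**: with a full set of roots, `R_k(p) ≤ (2n)^(1/2^k) · ρ(p)`: `k` root
squarings determine the root radius to relative accuracy `(2n)^(2^-k)`. [cite: BeckerEtAl2018, §3.2 (cf.;
the bound itself is folklore)] -/
theorem graeffeBound_le_mul_rootRadius {p : K[X]} (h : Multiset.card p.roots = p.natDegree) (k : ℕ) :
    graeffeBound p k ≤ (2 * p.natDegree : ℝ≥0) ^ (((2 ^ k : ℕ) : ℝ)⁻¹) * rootRadius p :=
  graeffeBound_le h (fun _ hz => nnnorm_le_rootRadius hz) k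

/-- `(2n)^(1/2^k) → 1`. [folklore] -/
private theorem tendsto_const_rpow_inv_two_pow {c : ℝ≥0} (hc : c ≠ 0) :
    Tendsto (fun k : ℕ => c ^ (((2 ^ k : ℕ) : ℝ)⁻¹)) atTop (𝓝 1) := by
  have he : Tendsto (fun k : ℕ => (((2 ^ k : ℕ) : ℝ)⁻¹)) atTop (𝓝 0) := by
    refine tendsto_inv_atTop_zero.comp ?_
    exact tendsto_natCast_atTop_atTop.comp (tendsto_pow_atTop_atTop_of_one_lt one_lt_two)
  rw [← NNReal.tendsto_coe]
  have hc' : (c : ℝ) ≠ 0 := by exact_mod_cast hc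
  have h2 := ((Real.continuousAt_const_rpow hc').tendsto).comp he
  rw [Real.rpow_zero] at h2
  refine h2.congr fun k => ?_
  simp [NNReal.coe_rpow]

/-- **Convergence of the Graeffe root-radius method**: `R_k(p) → ρ(p)` as `k → ∞` (full set of
roots). [cite: Hildebrand1987, §10.17] [cite: BeckerEtAl2018, §3.2] -/
theorem tendsto_graeffeBound {p : K[X]} (hp : p ≠ 0) (h : Multiset.card p.roots = p.natDegree) :
    Tendsto (graeffeBound p) atTop (𝓝 (rootRadius p)) := by
  rcases Nat.eq_zero_or_pos p.natDegree with hn | hn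
  · -- constant polynomial: no roots, everything is `0`
    have hc0 : Multiset.card p.roots = 0 := by rw [h, hn]
    have hr : rootRadius p = 0 := by
      rw [rootRadius, Multiset.card_eq_zero.mp hc0, Multiset.map_zero]; rfl
    have hb : ∀ k, graeffeBound p k = 0 := fun k =>
      le_antisymm (by simpa [hr, hn] using graeffeBound_le_mul_rootRadius h k) zero_le
    rw [hr]
    exact tendsto_const_nhds.congr fun k => (hb k).symm
  · have hc : (2 * p.natDegree : ℝ≥0) ≠ 0 := by positivity
    have hup : Tendsto (fun k => (2 * p.natDegree : ℝ≥0) ^ (((2 ^ k : ℕ) : ℝ)⁻¹) * rootRadius p)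
        atTop (𝓝 (rootRadius p)) := by
      have := (tendsto_const_rpow_inv_two_pow hc).mul_const (rootRadius p)
      rwa [one_mul] at this
    exact tendsto_of_tendsto_of_tendsto_of_le_of_le tendsto_const_nhds hup
      (fun k => rootRadius_le_graeffeBound hp k) (fun k => graeffeBound_le_mul_rootRadius h k)

end Normed

end Literature.Algebra.Polynomial.Graeffe
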